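import Summits.KontsevichZagierPeriods.KontsevichZagierPeriods.Theorems.K2SymbolChainsFigureEightIsTwoSmythJensenTools
import Summits.KontsevichZagierPeriods.KontsevichZagierPeriods.Theorems.K2SymbolChainsFigureEightIsTwoSmythProduct
import Summits.KontsevichZagierPeriods.KontsevichZagierPeriods.Theorems.K2SymbolChainsJensenIsScissorsBand

/-!
# `FigureEightIsTwoSmyth`: the Jensen step on the figure-eight side, real-root part (helper, conditional)

Item stmt-KontsevichZagierPeriods-5203 of route K2SymbolChains. Over the base `T₁ = {g(t) < −2}`
(`g = 16c⁴ − 20c² + 2`) the item's fibre bound factors as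
`F² = (g − 2c(s))² = |e(s) − L₊|² · |e(s) − L₋|²` with the REAL roots `L± = (g ∓ √(g²−4))/2` of
`L² − gL + 1` (`L₊ < −1 < L₋ < 0`, file `…Algebra`). Accordingly the part `r_A|T₁` of the unfolded
torus representation of `M(A_{4₁})` is, by the product rule for signed unfoldings (file `…Product`),
`[P₊] + [P₋]` with `P± = L(T₁, h_A, |e(s) − L±|²)`; the crux `JensenMove` (hypothesis) turns `P₊`
into the band `R_A = [{g < −2, 1 < u < L₊²}, 2/((1+t²)(1+s²)u)]` and `P₋` into the EMPTY band
(`|L₋| < 1`). Result (`exists_figureEightBand_of_jensenMove`): `R_A` exists and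
`[r_A|T₁] − [R_A] ∈ KZ.relations`. The absolute convergence of `P±` is obtained from that of `r_A`
(`log V± ≤ log 37`, `log V₊ + log V₋ = log F²`). [Kontsevich–Zagier 2001, §1.1–1.2; Jensen 1899;
Boyd 2002; folklore]
-/

noncomputable section

open MeasureTheory Set
open Literature.NumberTheory.Transcendental Literature.ModelTheory.ExponentialFields
open Summit.KontsevichZagierPeriods.K2SymbolChains.JensenIsScissorsProof

-- single-conjunct summit: Sub = Summit, so the namespace segment repeats by design (CONVENTIONS §2)
set_option linter.dupNamespace false

namespace Summit.KontsevichZagierPeriods.KontsevichZagierPeriods.Theorems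

open Literature.NumberTheory.Transcendental.KZ

/-- The three scissors move sets lie in `KZ.relations`. [Kontsevich–Zagier 2001, §1.2] [folklore] -/
theorem scissors_subset_relations : domainAddRel ∪ integrandAddRel ∪ changeOfVariablesRel ⊆ (relations : Set FormalRep) := by
  rintro c ((hc | hc) | hc)
  · exact domainAddRel_subset_relations hc
  · exact integrandAddRel_subset_relations hc
  · exact changeOfVariablesRel_subset_relations hc

/-- A bounded measurable multiple of the weight `2/(1+t²)` is integrable on any measurable `τ ⊆ ℝ¹`.
[folklore] -/
theorem integrableOn_weight₁_mul {τ : Set (Fin 1 → ℝ)} (hτm : MeasurableSet τ) {f : (Fin 1 → ℝ) → ℝ} (M : ℝ)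
    (hf : AEStronglyMeasurable f (volume.restrict τ)) (hb : ∀ x ∈ τ, |f x| ≤ M) :
    IntegrableOn (fun x : Fin 1 → ℝ => 2 / (1 + x 0 ^ 2) * f x) τ := by
  have hh := Summit.KontsevichZagierPeriods.K2SymbolChains.ClausenPi.integrable_h
  have hg : IntegrableOn (fun x : Fin 1 → ℝ => 2 * M * (1 / (1 + x 0 ^ 2))) τ := (hh.const_mul (2 * M)).integrableOn
  have hm : AEStronglyMeasurable (fun x : Fin 1 → ℝ => 2 / (1 + x 0 ^ 2) * f x) (volume.restrict τ) := by
    refine AEStronglyMeasurable.mul ?_ hf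
    have hne : ∀ x : Fin 1 → ℝ, (1 + x 0 ^ 2 : ℝ) ≠ 0 := fun x => by positivity
    exact (Continuous.div continuous_const (continuous_const.add ((continuous_apply 0).pow 2))
      hne).aestronglyMeasurable
  refine Integrable.mono' hg hm ?_
  filter_upwards [ae_restrict_mem hτm] with x hx
  have h0 : (0 : ℝ) < 1 + x 0 ^ 2 := by positivity
  rw [Real.norm_eq_abs, abs_mul, abs_of_pos (by positivity : (0:ℝ) < 2 / (1 + x 0 ^ 2))]
  have := hb x hx
  have h2 : 0 ≤ 2 / (1 + x 0 ^ 2) := by positivity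
  calc 2 / (1 + x 0 ^ 2) * |f x| ≤ 2 / (1 + x 0 ^ 2) * M := by gcongr
    _ = 2 * M * (1 / (1 + x 0 ^ 2)) := by ring

/-- A bounded measurable multiple of the weight `2/((1+t²)(1+s²))` is integrable on any measurable
`T ⊆ ℝ²`. [folklore] -/
theorem integrableOn_weight₂_mul {T : Set (Fin 2 → ℝ)} (hTm : MeasurableSet T) {f : (Fin 2 → ℝ) → ℝ} (M : ℝ)
    (hf : AEStronglyMeasurable f (volume.restrict T)) (hb : ∀ b ∈ T, |f b| ≤ M) :
    IntegrableOn (fun b : Fin 2 → ℝ => 2 / ((1 + b 0 ^ 2) * (1 + b 1 ^ 2)) * f b) T := by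
  have hg : IntegrableOn (fun b : Fin 2 → ℝ => M * (2 / ((1 + b 0 ^ 2) * (1 + b 1 ^ 2)))) T :=
    (integrable_weightA.const_mul M).integrableOn
  have hm : AEStronglyMeasurable (fun b : Fin 2 → ℝ => 2 / ((1 + b 0 ^ 2) * (1 + b 1 ^ 2)) * f b) (volume.restrict T) := by
    refine AEStronglyMeasurable.mul ?_ hf
    have hne : ∀ b : Fin 2 → ℝ, ((1 + b 0 ^ 2) * (1 + b 1 ^ 2) : ℝ) ≠ 0 := fun b => by positivity
    exact (Continuous.div continuous_const ((continuous_const.add ((continuous_apply 0).pow 2)).mul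
      (continuous_const.add ((continuous_apply 1).pow 2))) hne).aestronglyMeasurable
  refine Integrable.mono' hg hm ?_
  filter_upwards [ae_restrict_mem hTm] with b hb'
  rw [Real.norm_eq_abs, abs_mul, abs_of_pos (by positivity : (0:ℝ) < 2 / ((1 + b 0 ^ 2) * (1 + b 1 ^ 2)))]
  have := hb b hb'
  have h2 : 0 ≤ 2 / ((1 + b 0 ^ 2) * (1 + b 1 ^ 2)) := by positivity
  calc 2 / ((1 + b 0 ^ 2) * (1 + b 1 ^ 2)) * |f b| ≤ 2 / ((1 + b 0 ^ 2) * (1 + b 1 ^ 2)) * M := by gcongr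
    _ = M * (2 / ((1 + b 0 ^ 2) * (1 + b 1 ^ 2))) := by ring

set_option maxHeartbeats 400000 in
/-- **The real-root part of the Jensen step on the figure-eight side.** Assume `JensenMove`. Let `r₁`
be the restriction of the unfolded torus representation of `M(A_{4₁})` to the base `T₁ = {g(t) < −2}`
(signed unfolding of `h_A log F²` over `T₁ × ℝ`). Then the band representation
`R_A = [{g < −2, 1 < u < L₊(t)²}, 2/((1+t²)(1+s²)u)]` exists and `[r₁] − [R_A] ∈ KZ.relations`.
[Kontsevich–Zagier 2001, §1.1–1.2; Jensen 1899; Boyd 2002; folklore] -/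
theorem exists_figureEightBand_of_jensenMove (hJ : Theses.K2SymbolChains.JensenMove) (r₁ : IntegralRep 3)
    (hr₁d : r₁.domain = logUnfoldDomain {b : Fin 2 → ℝ |
      16 * ((1 - b 0 ^ 2) / (1 + b 0 ^ 2)) ^ 4 - 20 * ((1 - b 0 ^ 2) / (1 + b 0 ^ 2)) ^ 2 + 2 < -2}
      (fun b => (16 * ((1 - b 0 ^ 2) / (1 + b 0 ^ 2)) ^ 4 - 20 * ((1 - b 0 ^ 2) / (1 + b 0 ^ 2)) ^ 2 + 2 -
        2 * (1 - b 1 ^ 2) / (1 + b 1 ^ 2)) ^ 2))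
    (hr₁i : EqOn r₁.integrand (logUnfoldIntegrand fun b : Fin 2 → ℝ => 2 / ((1 + b 0 ^ 2) * (1 + b 1 ^ 2))) r₁.domain) :
    ∃ RA : IntegralRep 3, RA.domain = {z : Fin 3 → ℝ | Fin.init z ∈ {b : Fin 2 → ℝ |
      16 * ((1 - b 0 ^ 2) / (1 + b 0 ^ 2)) ^ 4 - 20 * ((1 - b 0 ^ 2) / (1 + b 0 ^ 2)) ^ 2 + 2 < -2} ∧
      1 < z (Fin.last 2) ∧ z (Fin.last 2) <
        ((16 * ((1 - (Fin.init z) 0 ^ 2) / (1 + (Fin.init z) 0 ^ 2)) ^ 4 -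
            20 * ((1 - (Fin.init z) 0 ^ 2) / (1 + (Fin.init z) 0 ^ 2)) ^ 2 + 2 -
          Real.sqrt ((16 * ((1 - (Fin.init z) 0 ^ 2) / (1 + (Fin.init z) 0 ^ 2)) ^ 4 -
            20 * ((1 - (Fin.init z) 0 ^ 2) / (1 + (Fin.init z) 0 ^ 2)) ^ 2 + 2) ^ 2 - 4)) / 2) ^ 2} ∧
      EqOn RA.integrand (fun z => 2 / ((1 + (Fin.init z) 0 ^ 2) * (1 + (Fin.init z) 1 ^ 2)) /
        z (Fin.last 2)) RA.domain ∧
      of r₁ - of RA ∈ relations := by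
  -- data: `g`, the roots `L±`, the base `T`, the weight `G`, the factors `V±`
  set g : ℝ → ℝ := fun t => 16 * ((1 - t ^ 2) / (1 + t ^ 2)) ^ 4 - 20 * ((1 - t ^ 2) / (1 + t ^ 2)) ^ 2 + 2 with hg
  set Lp : ℝ → ℝ := fun t => (g t - Real.sqrt (g t ^ 2 - 4)) / 2 with hLp
  set Lm : ℝ → ℝ := fun t => (g t + Real.sqrt (g t ^ 2 - 4)) / 2 with hLm
  set T : Set (Fin 2 → ℝ) := {b : Fin 2 → ℝ | g (b 0) < -2} with hT_def
  set G : (Fin 2 → ℝ) → ℝ := fun b => 2 / ((1 + b 0 ^ 2) * (1 + b 1 ^ 2)) with hG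
  set FA : (Fin 2 → ℝ) → ℝ := fun b => (g (b 0) - 2 * (1 - b 1 ^ 2) / (1 + b 1 ^ 2)) ^ 2 with hFA
  set Vp : (Fin 2 → ℝ) → ℝ := fun b => ((1 - b 1 ^ 2) / (1 + b 1 ^ 2) - Lp (b 0)) ^ 2 +
    (2 * b 1 / (1 + b 1 ^ 2)) ^ 2 with hVp
  set Vm : (Fin 2 → ℝ) → ℝ := fun b => ((1 - b 1 ^ 2) / (1 + b 1 ^ 2) - Lm (b 0)) ^ 2 +
    (2 * b 1 / (1 + b 1 ^ 2)) ^ 2 with hVm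
  -- elementary facts on `T`
  have hroots : ∀ t, g t < -2 → Lp t + Lm t = g t ∧ Lp t * Lm t = 1 ∧ Lp t < -1 ∧ -1 < Lm t ∧ Lm t < 0 := by
    intro t ht
    obtain ⟨h1, h2, -⟩ := real_roots_of_le_neg_two (g t) ht.le
    obtain ⟨h3, h4, h5⟩ := real_roots_of_lt_neg_two (g t) ht
    exact ⟨h1, h2, h3, h4, h5⟩
  have hgb : ∀ t, |g t| ≤ 5 := fun t => by
    have h1 : -5 ≤ g t := (torusG_bounds t).1
    have h2 : g t ≤ 2 := (torusG_bounds t).2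
    exact abs_le.2 ⟨by linarith, by linarith⟩
  have hLp5 : ∀ t, Lp t ^ 2 ≤ 25 := fun t => by
    have h : |Lp t| ≤ 5 := (abs_root_le (g t)).1.trans (hgb t)
    rw [← sq_abs]; nlinarith [abs_nonneg (Lp t)]
  have hLm5 : ∀ t, Lm t ^ 2 ≤ 25 := fun t => by
    have h : |Lm t| ≤ 5 := (abs_root_le (g t)).2.trans (hgb t)
    rw [← sq_abs]; nlinarith [abs_nonneg (Lm t)]
  have hLp5' : ∀ t, Lp t ^ 2 + (0:ℝ) ^ 2 ≤ 25 := fun t => by simpa using hLp5 t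
  have hLm5' : ∀ t, Lm t ^ 2 + (0:ℝ) ^ 2 ≤ 25 := fun t => by simpa using hLm5 t
  have hFVV : ∀ b ∈ T, FA b = Vp b * Vm b := fun b hb => by
    have h := torusF_sq_eq_mul_of_real_roots (b 0) (b 1) (le_of_lt hb)
    simp only [sub_zero] at h
    exact h
  have hVp0 : ∀ b ∈ T, 0 < Vp b := fun b hb => by
    obtain ⟨-, -, h3, -, -⟩ := hroots _ hb
    have hc : -1 ≤ (1 - b 1 ^ 2) / (1 + b 1 ^ 2) := by
      rw [le_div_iff₀ (by positivity)]; nlinarith [sq_nonneg (b 1)]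
    have : 0 < (1 - b 1 ^ 2) / (1 + b 1 ^ 2) - Lp (b 0) := by linarith
    show 0 < ((1 - b 1 ^ 2) / (1 + b 1 ^ 2) - Lp (b 0)) ^ 2 + (2 * b 1 / (1 + b 1 ^ 2)) ^ 2
    positivity
  have hVm0 : ∀ b ∈ T, 0 < Vm b := fun b hb => by
    obtain ⟨-, -, -, h4, h5⟩ := hroots _ hb
    have hcs := ratCircle_sq_add_sq (b 1)
    show 0 < ((1 - b 1 ^ 2) / (1 + b 1 ^ 2) - Lm (b 0)) ^ 2 + (2 * b 1 / (1 + b 1 ^ 2)) ^ 2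
    nlinarith [hcs, sq_nonneg ((1 - b 1 ^ 2) / (1 + b 1 ^ 2) + 1), sq_nonneg (2 * b 1 / (1 + b 1 ^ 2)),
      sq_nonneg ((1 - b 1 ^ 2) / (1 + b 1 ^ 2) - Lm (b 0))]
  have hFA0 : ∀ b ∈ T, 0 < FA b := fun b hb => by rw [hFVV b hb]; exact mul_pos (hVp0 b hb) (hVm0 b hb)
  -- semialgebraicity
  have hgs₂ : IsSemialgebraicFunOn ℚ (univ : Set (Fin 2 → ℝ)) (fun b => g (b 0)) :=
    isSemialgebraicFunOn_torusG isSemialgebraic_univ (0 : Fin 2)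
  have hT : IsSemialgebraic ℚ T := by
    have h := (IsSemialgebraicFunOn.add_holds hgs₂ (isSemialgebraicFunOn_ratCast isSemialgebraic_univ 2)).isSemialgebraic_sep_neg
    convert h using 1
    ext b
    simp only [hT_def, mem_setOf_eq, mem_univ, true_and, Pi.add_apply, Rat.cast_ofNat]
    constructor <;> intro h' <;> linarith
  have hTm : MeasurableSet T := IsSemialgebraic.measurableSet_holds hT
  have hτ : IsSemialgebraic ℚ {x : Fin 1 → ℝ | g (x 0) < -2} := by
    have hgs₁ : IsSemialgebraicFunOn ℚ (univ : Set (Fin 1 → ℝ)) (fun x => g (x 0)) :=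
      isSemialgebraicFunOn_torusG isSemialgebraic_univ (0 : Fin 1)
    have h := (IsSemialgebraicFunOn.add_holds hgs₁ (isSemialgebraicFunOn_ratCast isSemialgebraic_univ 2)).isSemialgebraic_sep_neg
    convert h using 1
    ext x
    simp only [mem_setOf_eq, mem_univ, true_and, Pi.add_apply, Rat.cast_ofNat]
    constructor <;> intro h' <;> linarith
  have hτm : MeasurableSet {x : Fin 1 → ℝ | g (x 0) < -2} := IsSemialgebraic.measurableSet_holds hτ
  have hGs : IsSemialgebraicFunOn ℚ T G := by
    have h := isSemialgebraicFunOn_weight hT 2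
    refine h.congr fun b _ => ?_
    show ((2:ℚ):ℝ) / ((1 + b 0 ^ 2) * (1 + b 1 ^ 2)) = G b
    push_cast; rfl
  obtain ⟨hLps₂, hLms₂⟩ := isSemialgebraicFunOn_realRoots hT (0 : Fin 2)
  obtain ⟨hLps₁, hLms₁⟩ := isSemialgebraicFunOn_realRoots hτ (0 : Fin 1)
  have hc₂ := isSemialgebraicFunOn_ratCos hT 1
  have hσ₂ := isSemialgebraicFunOn_ratSin hT 1
  have hVs : ∀ {L : (Fin 2 → ℝ) → ℝ}, IsSemialgebraicFunOn ℚ T L →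
      IsSemialgebraicFunOn ℚ T (fun b => ((1 - b 1 ^ 2) / (1 + b 1 ^ 2) - L b) ^ 2 +
        (2 * b 1 / (1 + b 1 ^ 2)) ^ 2) := by
    intro L hL
    have h1 := IsSemialgebraicFunOn.sub_holds hc₂ hL
    exact (IsSemialgebraicFunOn.add_holds (IsSemialgebraicFunOn.mul_holds h1 h1)
      (IsSemialgebraicFunOn.mul_holds hσ₂ hσ₂)).congr fun b _ => by
        simp only [Pi.add_apply, Pi.mul_apply, Pi.sub_apply]; ring
  have hVps : IsSemialgebraicFunOn ℚ T Vp := hVs (L := fun b => Lp (b 0)) hLps₂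
  have hVms : IsSemialgebraicFunOn ℚ T Vm := hVs (L := fun b => Lm (b 0)) hLms₂
  have hFAs : IsSemialgebraicFunOn ℚ T FA := isSemialgebraicFunOn_boundA hT
  -- integrability of `G log V±` by domination
  have hGint : IntegrableOn G T := integrable_weightA.integrableOn
  have hGF : IntegrableOn (fun b => G b * Real.log (FA b)) T := integrable_weightA_mul_log.integrableOn
  have hG0 : ∀ b ∈ T, 0 ≤ G b := fun b _ => by
    show (0:ℝ) ≤ 2 / ((1 + b 0 ^ 2) * (1 + b 1 ^ 2)); positivity
  have hmeas : ∀ {V : (Fin 2 → ℝ) → ℝ}, IsSemialgebraicFunOn ℚ T V →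
      AEStronglyMeasurable (fun b => G b * Real.log (V b)) (volume.restrict T) := fun hV =>
    (aestronglyMeasurable_of_isSemialgebraicFunOn hGs hTm).mul
      (Real.measurable_log.comp_aemeasurable
        (aestronglyMeasurable_of_isSemialgebraicFunOn hV hTm).aemeasurable).aestronglyMeasurable
  have hl37 : (0 : ℝ) ≤ Real.log 37 := Real.log_nonneg (by norm_num)
  have hupP : ∀ b, Real.log (Vp b) ≤ Real.log 37 := fun b => by
    have h := (jensenBound_le (hLp5' (b 0)) (b 1)).2
    simp only [sub_zero] at h
    exact h
  have hupM : ∀ b, Real.log (Vm b) ≤ Real.log 37 := fun b => by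
    have h := (jensenBound_le (hLm5' (b 0)) (b 1)).2
    simp only [sub_zero] at h
    exact h
  have hlogF : ∀ b ∈ T, Real.log (FA b) = Real.log (Vp b) + Real.log (Vm b) := fun b hb => by
    rw [hFVV b hb, Real.log_mul (hVp0 b hb).ne' (hVm0 b hb).ne']
  have hintP : IntegrableOn (fun b => G b * Real.log (Vp b)) T :=
    integrableOn_mul_log_of_le hTm (Real.log 37) (Real.log 37) hl37 hl37 hGint hGF hG0 (hmeas hVps)
      (ae_of_all _ hupP) ((ae_restrict_mem hTm).mono fun b hb => by rw [hlogF b hb]; linarith [hupM b])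
  have hintM : IntegrableOn (fun b => G b * Real.log (Vm b)) T :=
    integrableOn_mul_log_of_le hTm (Real.log 37) (Real.log 37) hl37 hl37 hGint hGF hG0 (hmeas hVms)
      (ae_of_all _ hupM) ((ae_restrict_mem hTm).mono fun b hb => by rw [hlogF b hb]; linarith [hupP b])
  -- the representations `P±`
  have hZ : ∀ {V : (Fin 2 → ℝ) → ℝ}, (∀ b ∈ T, 0 < V b) → volume {b | b ∈ T ∧ V b = 0} = 0 := by
    intro V hV
    rw [show {b | b ∈ T ∧ V b = 0} = ∅ by
      ext b; simp only [mem_setOf_eq, mem_empty_iff_false, iff_false, not_and]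
      exact fun hb h0 => (hV b hb).ne' h0, measure_empty]
  set Pp := logUnfoldRep T Vp G hT hGs hVps (fun b hb => (hVp0 b hb).le) (hZ hVp0) hintP with hPp
  set Pm := logUnfoldRep T Vm G hT hGs hVms (fun b hb => (hVm0 b hb).le) (hZ hVm0) hintM with hPm
  -- the product rule: `[r₁] − [P₊] − [P₋] ∈ relations`
  have hVpd : ∀ b ∈ T, DifferentiableAt ℝ Vp b := by
    intro b hb
    have h1 : ∀ t : ℝ, (1 + t ^ 2 : ℝ) ≠ 0 := fun t => by positivity
    have hgd : DifferentiableAt ℝ (fun b : Fin 2 → ℝ => g (b 0)) b := by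
      show DifferentiableAt ℝ (fun b : Fin 2 → ℝ => 16 * ((1 - b 0 ^ 2) / (1 + b 0 ^ 2)) ^ 4 -
        20 * ((1 - b 0 ^ 2) / (1 + b 0 ^ 2)) ^ 2 + 2) b
      fun_prop (disch := exact h1 _)
    have hpos : g (b 0) ^ 2 - 4 ≠ 0 := by have : g (b 0) < -2 := hb; nlinarith
    have hs : DifferentiableAt ℝ (fun b : Fin 2 → ℝ => Real.sqrt (g (b 0) ^ 2 - 4)) b :=
      ((hgd.pow 2).sub_const 4).sqrt hpos
    have hL : DifferentiableAt ℝ (fun b : Fin 2 → ℝ => Lp (b 0)) b := by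
      set G₁ : (Fin 2 → ℝ) → ℝ := fun b => g (b 0) with hG₁
      set S₁ : (Fin 2 → ℝ) → ℝ := fun b => Real.sqrt (g (b 0) ^ 2 - 4) with hS₁
      have hgd' : DifferentiableAt ℝ G₁ b := hgd
      have hs' : DifferentiableAt ℝ S₁ b := hs
      show DifferentiableAt ℝ (fun b : Fin 2 → ℝ => (G₁ b - S₁ b) / 2) b
      fun_prop
    have hc : DifferentiableAt ℝ (fun b : Fin 2 → ℝ => (1 - b 1 ^ 2) / (1 + b 1 ^ 2)) b := by
      fun_prop (disch := exact h1 _)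
    have hσ : DifferentiableAt ℝ (fun b : Fin 2 → ℝ => 2 * b 1 / (1 + b 1 ^ 2)) b := by
      fun_prop (disch := exact h1 _)
    show DifferentiableAt ℝ (fun b : Fin 2 → ℝ => ((1 - b 1 ^ 2) / (1 + b 1 ^ 2) - Lp (b 0)) ^ 2 +
      (2 * b 1 / (1 + b 1 ^ 2)) ^ 2) b
    exact ((hc.sub hL).pow 2).add (hσ.pow 2)
  have e₁ : of r₁ - of Pp - of Pm ∈ relations := by
    refine of_logUnfold_prod_sub_sub_mem scissors_subset_relations (G := G) hT hGs hVps hVms hVp0 hVm0 hVpd r₁ Pp Pm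
      ?_ hr₁i rfl (fun _ _ => rfl) rfl (fun _ _ => rfl)
    rw [hr₁d]
    ext z
    simp only [logUnfoldDomain, mem_setOf_eq]
    constructor
    · rintro ⟨hb, h⟩
      exact ⟨hb, by rw [← hFVV _ hb]; exact h⟩
    · rintro ⟨hb, h⟩
      exact ⟨hb, by rw [hFVV _ hb]; exact h⟩
  -- the band `R_A` and Jensen on `P₊`
  have hL2s : ∀ {L : (Fin 2 → ℝ) → ℝ}, IsSemialgebraicFunOn ℚ T L → IsSemialgebraicFunOn ℚ T (fun b => L b ^ 2) :=
    fun hL => (IsSemialgebraicFunOn.mul_holds hL hL).congr fun b _ => by simp only [Pi.mul_apply]; ring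
  have hbs : IsSemialgebraicFunOn ℚ T (fun b => Lp (b 0) ^ 2) := hL2s (L := fun b => Lp (b 0)) hLps₂
  have hGL : IntegrableOn (fun b => G b * Real.log ((fun b => Lp (b 0) ^ 2) b)) T := by
    have hm : AEStronglyMeasurable (fun b => Real.log (Lp (b 0) ^ 2)) (volume.restrict T) :=
      (Real.measurable_log.comp_aemeasurable
        (aestronglyMeasurable_of_isSemialgebraicFunOn hbs hTm).aemeasurable).aestronglyMeasurable
    refine integrableOn_weight₂_mul hTm (Real.log 25) hm fun b hb => ?_
    obtain ⟨-, -, h3, -, -⟩ := hroots _ hb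
    have h25 := hLp5 (b 0)
    have h1 : 1 ≤ Lp (b 0) ^ 2 := by nlinarith
    rw [abs_of_nonneg (Real.log_nonneg h1)]
    exact Real.log_le_log (by linarith) h25
  have hc1 : IsSemialgebraicFunOn ℚ T (fun _ => (1 : ℝ)) := by simpa using isSemialgebraicFunOn_ratCast hT 1
  obtain ⟨RA, hRAd, hRAi⟩ := exists_bandRep (a := fun _ => (1 : ℝ)) (b := fun b => Lp (b 0) ^ 2) hT hGs hc1 hbs
    (fun _ _ => one_pos) (fun b hb => by obtain ⟨-, -, h3, -, -⟩ := hroots _ hb; nlinarith) (by simp) hGL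
  have hintJ : ∀ {L : ℝ → ℝ}, IsSemialgebraicFunOn ℚ {x : Fin 1 → ℝ | g (x 0) < -2} (fun x => L (x 0)) →
      (∀ t, g t < -2 → 1 / 25 ≤ L t ^ 2 ∧ L t ^ 2 ≤ 25) →
      IntegrableOn (fun x : Fin 1 → ℝ => 2 / (1 + x 0 ^ 2) * (1 + |Real.log (L (x 0) ^ 2)|))
        {x : Fin 1 → ℝ | g (x 0) < -2} := by
    intro L hL hLb
    have hL2 : IsSemialgebraicFunOn ℚ {x : Fin 1 → ℝ | g (x 0) < -2} (fun x => L (x 0) ^ 2) :=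
      (IsSemialgebraicFunOn.mul_holds hL hL).congr fun x _ => by simp only [Pi.mul_apply]; ring
    have hm : AEStronglyMeasurable (fun x : Fin 1 → ℝ => 1 + |Real.log (L (x 0) ^ 2)|)
        (volume.restrict {x : Fin 1 → ℝ | g (x 0) < -2}) := by
      refine aestronglyMeasurable_const.add ?_
      exact ((Real.measurable_log.comp_aemeasurable
        (aestronglyMeasurable_of_isSemialgebraicFunOn hL2 hτm).aemeasurable).abs).aestronglyMeasurable
    refine integrableOn_weight₁_mul hτm (1 + Real.log 25) hm fun x hx => ?_
    obtain ⟨hlo, hhi⟩ := hLb _ hx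
    have hpos : 0 < L (x 0) ^ 2 := by linarith
    rw [abs_of_nonneg (by positivity)]
    have h1 : Real.log (L (x 0) ^ 2) ≤ Real.log 25 := Real.log_le_log hpos hhi
    have h2 : Real.log (1 / 25) ≤ Real.log (L (x 0) ^ 2) := Real.log_le_log (by norm_num) hlo
    rw [Real.log_div one_ne_zero (by norm_num), Real.log_one, zero_sub] at h2
    have := abs_le.2 ⟨by linarith, h1⟩
    linarith
  have hLpb : ∀ t, g t < -2 → 1 / 25 ≤ Lp t ^ 2 ∧ Lp t ^ 2 ≤ 25 := fun t ht => by
    obtain ⟨-, -, h3, -, -⟩ := hroots t ht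
    exact ⟨by nlinarith, hLp5 t⟩
  have hLmb : ∀ t, g t < -2 → 1 / 25 ≤ Lm t ^ 2 ∧ Lm t ^ 2 ≤ 25 := fun t ht => by
    obtain ⟨-, h2, h3, h4, h5⟩ := hroots t ht
    have h25 : Lp t ^ 2 ≤ 25 := hLp5 t
    refine ⟨?_, hLm5 t⟩
    have : Lp t ^ 2 * Lm t ^ 2 = 1 := by nlinarith
    by_contra hcon
    have hlt : Lm t ^ 2 < 1 / 25 := not_le.1 hcon
    nlinarith [sq_nonneg (Lp t), sq_nonneg (Lm t)]
  have e₂ : of Pp - of RA ∈ relations :=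
    jensen_sub_band_mem_real hJ (p := fun t => g t < -2) (a := Lp) hτ hLps₁ (hintJ hLps₁ hLpb) Pp RA
      rfl (fun _ _ => rfl) hRAd (by rw [hRAi]; exact fun _ _ => rfl)
  -- Jensen on `P₋`: the empty band
  obtain ⟨Rm, hRmd, hRmi, e₄⟩ := exists_emptyBand_real (p := fun t => g t < -2) (a := Lm)
    (fun t ht => by obtain ⟨-, -, -, h4, h5⟩ := hroots t ht; nlinarith)
  have e₃ : of Pm - of Rm ∈ relations :=
    jensen_sub_band_mem_real hJ (p := fun t => g t < -2) (a := Lm) hτ hLms₁ (hintJ hLms₁ hLmb) Pm Rm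
      rfl (fun _ _ => rfl) hRmd hRmi
  -- assemble
  refine ⟨RA, hRAd, ?_, ?_⟩
  · rw [hRAi]
    exact fun _ _ => rfl
  · have : of r₁ - of RA = (of r₁ - of Pp - of Pm) + (of Pp - of RA) + (of Pm - of Rm) + of Rm := by abel
    rw [this]
    exact relations.add_mem (relations.add_mem (relations.add_mem e₁ e₂) e₃) e₄

end Summit.KontsevichZagierPeriods.KontsevichZagierPeriods.Theorems
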